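import Summits.CriticalPhenomena.PercolationContinuityZ3.Theorems.Transplant.FKConnectivityAllQAntipodalRootFormBase
import Summits.CriticalPhenomena.PercolationContinuityZ3.Theorems.Transplant.FKConnectivityAllQAntipodalMinorDefs

/-!
# Connectivity correlation inequalities for `φ_{w,q}`, every `q > 0` — ROOT-FORM CALCULUS, file 61k (DEFINITIONS): the table of a REAL box
# and the REAL two-special environment

Definitions file (`--supports stmt-CriticalPhenomena-4575`), FK sub-lane `prim-bschramm-fk-2` (gen 29); builds on p205010 (kernel theorem,
internal audit signed; external expert review pending).  No theorems, no named facts, no sorries.  Memo FROM-fk-2-g28-ROOT-FORM.md §7 (L4a).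

The abstract root-form calculus (files 61a–61e, `FK.RootForm.*`) treats a one-special box through its table `B → Base.BDat`: for every
configuration of the box's free edges, the level (two-replica cluster count) and the two pole-connection bits, once with the special edge in
the second replica (`t0`) and once with it in the first (`t1`).  This file fixes the table of a REAL box — an edge set of the host with poles
`a, b`, special edge `y`, cell `M` (free) / `C` (contracted) — in the tree's vocabulary: the level is `FK.apExpC (insert y M) C` of the
replica-1 edge set (`clusterCount` of both replicas, Grimmett's `k(ω)`), the bits are open-path indicators `a ↔ b` (`openGraph … .Reachable`)
in the two replicas; likewise `realEnv` is the `FK.RootForm.Env` (four pattern data per configuration) of a real edge set with two special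
edges `y, z`.  Configurations are indexed by the subtype `↥M.powerset` (a `Fintype` ordered by inclusion), as the abstract theorems require.  The bridge theorems (consistency of the local types, the single-box inequalities A1 / A3n / A4n from Theorem U) are in the sibling
proof files.
[cite: Grimmett2006, §1.4 eq. (1.20) (p. 15); §3.8 (pp. 61–62)]
-/

noncomputable section

namespace Summit.CriticalPhenomena.PercolationContinuityZ3.Theorems

namespace FK

namespace RootForm

open Literature.Probability.LatticeModels Literature.Probability.Percolation
open scoped Classical

variable {V : Type*}

/-- Boolean open-path indicator: `reachB X a b = true` iff `a ↔ b` in the open graph of the edge set `X` (the Boolean form of `FK.apConn`).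
[cite: Grimmett2006, §1.4 (p. 15)] -/
def reachB (X : Finset (Sym2 V)) (a b : V) : Bool := decide ((openGraph (↑X : BondConfig V)).Reachable a b)

/-- State datum of a real box at one replica-1 edge set `X` (specials already placed): level `apExpC (insert y M) C X = k(X ∪ C) + k(((M ∪ y) \ X) ∪ C)`
and the pole bits `a ↔ b` of the two replicas. [cite: Grimmett2006, §1.4 eq. (1.20) (p. 15)] -/
def realSDat [Fintype V] (M C : Finset (Sym2 V)) (a b : V) (y : Sym2 V) (X : Finset (Sym2 V)) : Base.SDat :=
  ⟨(apExpC (insert y M) C X : ℤ), reachB (X ∪ C) a b, reachB (insert y M \ X ∪ C) a b⟩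

/-- **The table of a real box.**  Box with poles `a, b`, special edge `y`, cell `M` free / `C` contracted (both inside the box, off `y`);
configuration `β ⊆ M` = the free edges in replica 1 (replica 2 carries `M \ β`; `C` is in both).  State `t0`: `y` in replica 2; state `t1`: `y` in
replica 1. [cite: Grimmett2006, §1.4 eq. (1.20) (p. 15); §3.8 (pp. 61–62)] -/
def realBox [Fintype V] (M C : Finset (Sym2 V)) (a b : V) (y : Sym2 V) (β : ↥M.powerset) : Base.BDat :=
  ⟨realSDat M C a b y β.1, realSDat M C a b y (insert y β.1)⟩

/-- Pattern datum of a real two-special environment at one replica-1 edge set `X` (specials already placed): level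
`apExpC (M ∪ {y,z}) C X` and the pole bits `a ↔ b` of the two replicas (`FK.RootForm.PDat`). [cite: Grimmett2006, §1.4 eq. (1.20) (p. 15)] -/
def realPDat [Fintype V] (M C : Finset (Sym2 V)) (a b : V) (y z : Sym2 V) (X : Finset (Sym2 V)) : PDat :=
  ⟨(apExpC (insert y (insert z M)) C X : ℤ), reachB (X ∪ C) a b, reachB (insert y (insert z M) \ X ∪ C) a b⟩

/-- **The real two-special environment** of an edge set with poles `a, b`, special edges `y, z`, cell `M` free / `C` contracted (inside the
edge set, off `y, z`): configuration `β ⊆ M` ↦ the four pattern data (`d0`: both specials in replica 2; `dy`, `dz`: one in replica 1; `dyz`: both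
in replica 1) — the `FK.RootForm.Env` of file 61a realised in the tree's vocabulary. [cite: Grimmett2006, §1.4 eq. (1.20) (p. 15); §3.8 (pp. 61–62)] -/
def realEnv [Fintype V] (M C : Finset (Sym2 V)) (a b : V) (y z : Sym2 V) : Env ↥M.powerset := fun β =>
  ⟨realPDat M C a b y z β.1, realPDat M C a b y z (insert y β.1), realPDat M C a b y z (insert z β.1),
    realPDat M C a b y z (insert y (insert z β.1))⟩

end RootForm

end FK

end Summit.CriticalPhenomena.PercolationContinuityZ3.Theorems

end
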